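import Summits.BirchSwinnertonDyer.BirchSwinnertonDyer.Theorems.PrintCf2SplitBadTwoOrdinaryFiltrationNamedSign
import Summits.BirchSwinnertonDyer.BirchSwinnertonDyer.Theorems.PrintCf2SplitBadTwoCMPrimaryLocalPinning
import HarnessLib

/-!
# Crux `PrintCf2.SplitBadTwoRankOneOfFacts` (item stmt-BirchSwinnertonDyer-20368), road α over the CM field:
# THE LOCAL CHARACTERS OF THE CM SUMMANDS AT `𝔭 ∣ 2` WITH THE TWIST SIGN NAMED — `χ_d(σ)·αⁿ` and `χ_d(σ)·ε(res σ)·α^{−n}`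

Cell `bsd-print-cf2`, width seat `bsd-line-cf2-p1-w2` g8; `--supports stmt-BirchSwinnertonDyer-20368` (helper). HONEST FRAMING: nothing
here closes a crux or a stub; BSD is not proved by any of this; no summit statement is proved by this seat. THEOREMS ONLY (no
definition, no named fact, no `sorry`). FILE 8 of the -w2 g8 pinning series (FILE 7 `…OrdinaryFiltrationNamedSign` + FILE 1/2 engine).

WHAT. FILE 2's `endEigenPrimaryTorsion_two_localTypes` gives the local characters of the two CM summands `E[𝔮_ρ^∞]`, `E[𝔮_{ρ'}^∞]`
(`(W.baseChange K).endEigenPrimaryTorsion 2 π ·`, p646843) at a degree-one `𝔭 ∣ 2` with ANONYMOUS signs `±`. Here, for a member given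
as in the frames — `C₁ • W = cm7.quadraticTwist d`, `d ≠ 0` — the sign is NAMED: `s(σ) = +1` if `res σ` fixes `ι(√d) ∈ K̄`, `−1` if it
negates it (`ι = absClosureEmbedding ℚ K`, `√d = WeierstrassCurve.geomSqrt d`; every `σ` does one or the other,
`smul_absClosureEmbedding_geomSqrt_eq_or`), i.e. `s = χ_d`, the quadratic twist character:
* **`endEigenPrimaryTorsion_two_localTypes_named`** — `j(W) = −3375`-class member `C₁ • W = cm7.quadraticTwist d`, `K ∋ θ`, `θ² = −7`,
  `𝔭 ∣ 2` with `f(𝔭|2) = 1`, `π² = π − 2`, `r² = r − 2`: the roots are ordered `(ρ, ρ')`, there is a unit `α`, `α² = α − 2`, `α ∈ {r, 1 − r}`,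
  and every `σ ∈ Γ_{K_𝔭}` of Frobenius degree `n` acts on `E[𝔮_ρ^∞][2^k]` as any `N ≡ χ_d(σ)·αⁿ` and on `E[𝔮_{ρ'}^∞][2^k]` as any
  `N ≡ χ_d(σ)·ε(res σ)·α^{−n}` — Deuring's `ψ_{W}|_{D_𝔭}` on the two summands, explicitly;
* `endEigenPrimaryTorsion_two_localTypes_named_of_pinned` — the same keyed to the v9.1 pinning clause: if `GreenbergSelmer.inertia 𝔭` acts on
  `E[𝔮_ρ^∞]` through `{±1}` then `E[𝔮_ρ^∞]` carries `χ_d(σ)·αⁿ` and `E[𝔮_{1−ρ}^∞]` carries `χ_d(σ)·ε(res σ)·α^{−n}` at `𝔭`.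
With these the dyadic values of S3c₂ (`#W*(K_v)`, `#W*(K_v̄)`, FILE 6) become computable as functions of `[d]₂`. beyond-print theorem: no.

References: K. Rubin, LNM 1716 (1999) §3 Lemma 3.6 (ii), Thm. 3.15 (ii), Cor. 3.17; R. Greenberg, LNM 1716 (1999) §2 p. 70; [SilvermanAEC2009]
X.5 Cor. 5.4, 5.4.1.
-/

noncomputable section

open scoped Classical

set_option linter.dupNamespace false
set_option autoImplicit false

namespace Summit.BirchSwinnertonDyer.BirchSwinnertonDyer.Theorems.PrintCf2.CMPrimes

open NumberField IsDedekindDomain Field WeierstrassCurve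
  Literature.NumberTheory.EllipticCurves Literature.NumberTheory.EllipticCurves.GreenbergSelmer
  Literature.NumberTheory.GaloisRepresentations

variable (W : WeierstrassCurve ℚ) [W.IsElliptic] (K : Type) [Field K] [NumberField K]

/-- **THE LOCAL CHARACTERS OF THE CM SUMMANDS AT `𝔭 ∣ 2`, SIGN NAMED.** For `C₁ • W = cm7.quadraticTwist d` (`d ≠ 0`, so `j(W) = −3375`),
`K ∋ θ` with `θ² = −7`, `𝔭 ∣ 2` with `f(𝔭|2) = 1`, `π ∈ End_K(E_K)` with `π² = π − 2`, `r² = r − 2`: the roots are ordered `(ρ, ρ')` and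
there is a unit `α`, `α² = α − 2`, `α ∈ {r, 1 − r}`, such that for every `σ ∈ Γ_{K_𝔭}` of Frobenius degree `n`, with `s = +1` if
`res σ • ι(√d) = ι(√d)` and `s = −1` if `res σ • ι(√d) = −ι(√d)`: (U) `res σ` acts on `E[𝔮_ρ^∞][2^k]` as any `N ≡ s·αⁿ (mod 2^k)`;
(R) `res σ` acts on `E[𝔮_{ρ'}^∞][2^k]` as any `N ≡ s·ε(res σ)·α^{−n} (mod 2^k)`.
[cite: Rubin1999, §3 Lemma 3.6 (ii), Thm. 3.15 (ii), Cor. 3.17] [cite: GreenbergLNM1716, §2 p. 70] [cite: SilvermanAEC2009, X.5 Cor. 5.4] -/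
theorem endEigenPrimaryTorsion_two_localTypes_named (hj : W.j = -3375) {θ : K} (hθ : θ ^ 2 = -7)
    (π : (W.baseChange K).endRing) (hrel : (π : AddMonoid.End (W.baseChange K).geomPoints) * π = π - 2)
    {r : ℤ_[2]} (hr : r * r = r - 2) {d : ℚ} (hd : d ≠ 0) (C₁ : VariableChange ℚ) (hC₁ : C₁ • W = cm7.quadraticTwist d)
    (𝔭 : HeightOneSpectrum (𝓞 K)) (h𝔭 : ((2 : ℕ) : 𝓞 K) ∈ 𝔭.asIdeal) (hf : 𝔭.asIdeal.inertiaDeg (𝓞 ℚ) = 1) :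
    ∃ (ρ ρ' : ℤ_[2]) (α : ℤ_[2]ˣ), ((ρ = r ∧ ρ' = 1 - r) ∨ (ρ = 1 - r ∧ ρ' = r)) ∧
      (α : ℤ_[2]) ^ 2 = (α : ℤ_[2]) - 2 ∧ ((α : ℤ_[2]) = r ∨ (α : ℤ_[2]) = 1 - r) ∧
      ∀ (σ : absoluteGaloisGroup (𝔭.adicCompletion K)) (n : ℕ), IsFrobPow σ (n : ℤ) →
        ∀ s : ℤ,
          ((absGaloisRestrict K (𝔭.adicCompletion K) σ • absClosureEmbedding ℚ K (WeierstrassCurve.geomSqrt d) =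
              absClosureEmbedding ℚ K (WeierstrassCurve.geomSqrt d) ∧ s = 1) ∨
           (absGaloisRestrict K (𝔭.adicCompletion K) σ • absClosureEmbedding ℚ K (WeierstrassCurve.geomSqrt d) =
              -absClosureEmbedding ℚ K (WeierstrassCurve.geomSqrt d) ∧ s = -1)) →
          (∀ (k : ℕ), ∀ x ∈ (W.baseChange K).endEigenPrimaryTorsion 2 π ρ, 2 ^ k • x = 0 →
            ∀ N : ℤ, ((N : ℤ_[2]) - s * ((α ^ n : ℤ_[2]ˣ) : ℤ_[2])) ∈ (Ideal.span {(2 : ℤ_[2]) ^ k} : Ideal ℤ_[2]) →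
              absGaloisRestrict K (𝔭.adicCompletion K) σ • x = N • x) ∧
          (∀ (k : ℕ), ∀ x ∈ (W.baseChange K).endEigenPrimaryTorsion 2 π ρ', 2 ^ k • x = 0 →
            ∀ N : ℤ, ((N : ℤ_[2]) - s *
                ((GaloisRep.cyclotomicCharacter K 2 (absGaloisRestrict K (𝔭.adicCompletion K) σ) * (α⁻¹) ^ n :
                  ℤ_[2]ˣ) : ℤ_[2])) ∈ (Ideal.span {(2 : ℤ_[2]) ^ k} : Ideal ℤ_[2]) →
              absGaloisRestrict K (𝔭.adicCompletion K) σ • x = N • x) := by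
  haveI : Fact (Nat.Prime 2) := ⟨Nat.prime_two⟩
  have hr' : (1 - r) * (1 - r) = (1 - r) - 2 := by linear_combination hr
  -- the NAMED datum
  obtain ⟨C, α, hα, hcharN⟩ := ordinaryFiltration_two_namedSign W K hd C₁ hC₁ 𝔭 h𝔭 hf
  -- its anonymous shadow, for FILE 1's dichotomy
  have hchar : ∀ (σ : absoluteGaloisGroup (𝔭.adicCompletion K)) (n : ℕ), IsFrobPow σ (n : ℤ) →
      ∃ s₁ s₂ : ℤ, (s₁ = 1 ∨ s₁ = -1) ∧ (s₂ = 1 ∨ s₂ = -1) ∧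
        (∀ (k : ℕ) (x : (W.baseChange K).geomPrimaryTorsion 2), 2 ^ k • x ∈ C →
          ∀ N : ℤ, ((N : ℤ_[2]) - s₂ * ((α ^ n : ℤ_[2]ˣ) : ℤ_[2])) ∈ (Ideal.span {(2 : ℤ_[2]) ^ k} : Ideal ℤ_[2]) →
            absGaloisRestrict K (𝔭.adicCompletion K) σ • x - N • x ∈ C) ∧
        (∀ (k : ℕ) (c : (W.baseChange K).geomPrimaryTorsion 2), c ∈ C → 2 ^ k • c = 0 →
          ∀ N : ℤ, ((N : ℤ_[2]) - s₁ *
              ((GaloisRep.cyclotomicCharacter K 2 (absGaloisRestrict K (𝔭.adicCompletion K) σ) * (α⁻¹) ^ n :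
                ℤ_[2]ˣ) : ℤ_[2])) ∈ (Ideal.span {(2 : ℤ_[2]) ^ k} : Ideal ℤ_[2]) →
            absGaloisRestrict K (𝔭.adicCompletion K) σ • c = N • c) := by
    intro σ n hσ
    rcases smul_absClosureEmbedding_geomSqrt_eq_or K d (absGaloisRestrict K (𝔭.adicCompletion K) σ) with h | h
    · obtain ⟨hq, hl⟩ := hcharN σ n hσ 1 (Or.inl ⟨h, rfl⟩)
      exact ⟨1, 1, Or.inl rfl, Or.inl rfl, hq, hl⟩
    · obtain ⟨hq, hl⟩ := hcharN σ n hσ (-1) (Or.inr ⟨h, rfl⟩)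
      exact ⟨-1, -1, Or.inr rfl, Or.inr rfl, hq, hl⟩
  -- the dichotomy of FILE 1
  obtain ⟨τ₀, hτ₀, hu₁, -⟩ := exists_isFrobPow_zero_cyclotomicCharacter_ne K 𝔭 h𝔭
  obtain ⟨ρ, ρ', hρρ', hnot, hle, -, -⟩ :=
    endEigenPrimaryTorsion_two_localTypes_of_datum W K hj hθ π hrel hr 𝔭 C α hchar hτ₀ hu₁
  have hρ : ρ * ρ = ρ - 2 := by
    rcases hρρ' with ⟨rfl, -⟩ | ⟨rfl, -⟩
    · exact hr
    · exact hr'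
  refine ⟨ρ, ρ', α, hρρ', hα, eq_or_eq_one_sub_of_root_two (by rw [← sq]; exact hα) hr, fun σ n hσ s hs ↦ ?_⟩
  obtain ⟨hquot, hline⟩ := hcharN σ n hσ s hs
  exact ⟨endEigenPrimaryTorsion_two_smul_eq_of_not_le W K hj hθ π hrel hρ hnot _ hquot,
    fun k x hx hxk N hN ↦ hline k x (hle hx) hxk N hN⟩

/-- **THE SAME, KEYED TO THE v9.1 PINNING CLAUSE.** If `(π, ρ)` is pinned at `𝔭` (`GreenbergSelmer.inertia 𝔭` acts on `E[𝔮_ρ^∞]` pointwise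
through `{±1}`), then at `𝔭`: `E[𝔮_ρ^∞]` carries `χ_d(σ)·αⁿ` and `E[𝔮_{1−ρ}^∞]` carries `χ_d(σ)·ε(res σ)·α^{−n}` (some unit `α`, `α² = α − 2`,
`α ∈ {ρ, 1 − ρ}`), the sign `χ_d(σ) = ±1` according as `res σ` fixes or negates `ι(√d)`.
[cite: Rubin1999, §3 Lemma 3.6 (ii), Thm. 3.15 (ii), Cor. 3.17] [cite: GreenbergLNM1716, §2 p. 70] -/
theorem endEigenPrimaryTorsion_two_localTypes_named_of_pinned (hj : W.j = -3375) {θ : K} (hθ : θ ^ 2 = -7)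
    (π : (W.baseChange K).endRing) (hrel : (π : AddMonoid.End (W.baseChange K).geomPoints) * π = π - 2)
    {ρ : ℤ_[2]} (hρ : ρ * ρ = ρ - 2) {d : ℚ} (hd : d ≠ 0) (C₁ : VariableChange ℚ) (hC₁ : C₁ • W = cm7.quadraticTwist d)
    (𝔭 : HeightOneSpectrum (𝓞 K)) (h𝔭 : ((2 : ℕ) : 𝓞 K) ∈ 𝔭.asIdeal) (hf : 𝔭.asIdeal.inertiaDeg (𝓞 ℚ) = 1)
    (hclause : ∀ τ ∈ GreenbergSelmer.inertia 𝔭, ∀ x ∈ (W.baseChange K).endEigenPrimaryTorsion 2 π ρ, τ • x = x ∨ τ • x = -x) :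
    ∃ α : ℤ_[2]ˣ, (α : ℤ_[2]) ^ 2 = (α : ℤ_[2]) - 2 ∧ ((α : ℤ_[2]) = ρ ∨ (α : ℤ_[2]) = 1 - ρ) ∧
      ∀ (σ : absoluteGaloisGroup (𝔭.adicCompletion K)) (n : ℕ), IsFrobPow σ (n : ℤ) →
        ∀ s : ℤ,
          ((absGaloisRestrict K (𝔭.adicCompletion K) σ • absClosureEmbedding ℚ K (WeierstrassCurve.geomSqrt d) =
              absClosureEmbedding ℚ K (WeierstrassCurve.geomSqrt d) ∧ s = 1) ∨
           (absGaloisRestrict K (𝔭.adicCompletion K) σ • absClosureEmbedding ℚ K (WeierstrassCurve.geomSqrt d) =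
              -absClosureEmbedding ℚ K (WeierstrassCurve.geomSqrt d) ∧ s = -1)) →
          (∀ (k : ℕ), ∀ x ∈ (W.baseChange K).endEigenPrimaryTorsion 2 π ρ, 2 ^ k • x = 0 →
            ∀ N : ℤ, ((N : ℤ_[2]) - s * ((α ^ n : ℤ_[2]ˣ) : ℤ_[2])) ∈ (Ideal.span {(2 : ℤ_[2]) ^ k} : Ideal ℤ_[2]) →
              absGaloisRestrict K (𝔭.adicCompletion K) σ • x = N • x) ∧
          (∀ (k : ℕ), ∀ x ∈ (W.baseChange K).endEigenPrimaryTorsion 2 π (1 - ρ), 2 ^ k • x = 0 →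
            ∀ N : ℤ, ((N : ℤ_[2]) - s *
                ((GaloisRep.cyclotomicCharacter K 2 (absGaloisRestrict K (𝔭.adicCompletion K) σ) * (α⁻¹) ^ n :
                  ℤ_[2]ˣ) : ℤ_[2])) ∈ (Ideal.span {(2 : ℤ_[2]) ^ k} : Ideal ℤ_[2]) →
              absGaloisRestrict K (𝔭.adicCompletion K) σ • x = N • x) := by
  haveI : Fact (Nat.Prime 2) := ⟨Nat.prime_two⟩
  obtain ⟨ρ₁, ρ₂, α, hρρ, hα, hαρ, hUR⟩ :=
    endEigenPrimaryTorsion_two_localTypes_named W K hj hθ π hrel hρ hd C₁ hC₁ 𝔭 h𝔭 hf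
  -- which ordering? the one with `ρ₁ = ρ`: otherwise the (R)-clause at an inertia element with `ε ∉ {±1}` contradicts the pinning clause
  rcases hρρ with ⟨rfl, rfl⟩ | ⟨rfl, rfl⟩
  · exact ⟨α, hα, hαρ, hUR⟩
  · exfalso
    obtain ⟨τ₀, hτ₀, hu₁, hu₂⟩ := exists_isFrobPow_zero_cyclotomicCharacter_ne K 𝔭 h𝔭
    set u : ℤ_[2]ˣ := GaloisRep.cyclotomicCharacter K 2 (absGaloisRestrict K (𝔭.adicCompletion K) τ₀) with hu_def
    have hu₁' : (u : ℤ_[2]) ≠ 1 := fun h ↦ hu₁ (Units.ext h)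
    have hu₂' : (u : ℤ_[2]) ≠ -1 := fun h ↦ hu₂ (Units.ext (by rw [h, Units.val_neg, Units.val_one]))
    have hmem : absGaloisRestrict K (𝔭.adicCompletion K) τ₀ ∈ GreenbergSelmer.inertia 𝔭 :=
      Subgroup.mem_map.mpr ⟨τ₀, isFrobPow_zero_iff_mem_absInertia.mp hτ₀, rfl⟩
    -- the sign of `τ₀`
    obtain ⟨s, hs, hsd⟩ : ∃ s : ℤ, (s = 1 ∨ s = -1) ∧
        ((absGaloisRestrict K (𝔭.adicCompletion K) τ₀ • absClosureEmbedding ℚ K (WeierstrassCurve.geomSqrt d) =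
            absClosureEmbedding ℚ K (WeierstrassCurve.geomSqrt d) ∧ s = 1) ∨
         (absGaloisRestrict K (𝔭.adicCompletion K) τ₀ • absClosureEmbedding ℚ K (WeierstrassCurve.geomSqrt d) =
            -absClosureEmbedding ℚ K (WeierstrassCurve.geomSqrt d) ∧ s = -1)) := by
      rcases smul_absClosureEmbedding_geomSqrt_eq_or K d (absGaloisRestrict K (𝔭.adicCompletion K) τ₀) with h | h
      · exact ⟨1, Or.inl rfl, Or.inl ⟨h, rfl⟩⟩
      · exact ⟨-1, Or.inr rfl, Or.inr ⟨h, rfl⟩⟩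
    obtain ⟨-, hR⟩ := hUR τ₀ 0 (by exact_mod_cast hτ₀) s hsd
    simp only [pow_zero, mul_one] at hR
    have ht₁ : (s : ℤ_[2]) * (u : ℤ_[2]) ≠ 1 := by
      rcases hs with rfl | rfl
      · push_cast; rw [one_mul]; exact hu₁'
      · push_cast; rw [neg_one_mul]; exact fun h ↦ hu₂' (by rw [← h, neg_neg])
    have ht₂ : (s : ℤ_[2]) * (u : ℤ_[2]) ≠ -1 := by
      rcases hs with rfl | rfl
      · push_cast; rw [one_mul]; exact hu₂'
      · push_cast; rw [neg_one_mul]; exact fun h ↦ hu₁' (neg_injective h)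
    obtain ⟨k, x, hx, -, hx₁, hx₂⟩ := endEigenPrimaryTorsion_two_exists_smul_ne W K hj hθ π hrel hρ _ ht₁ ht₂ hR
    rcases hclause _ hmem x hx with h | h
    · exact hx₁ h
    · exact hx₂ h

end Summit.BirchSwinnertonDyer.BirchSwinnertonDyer.Theorems.PrintCf2.CMPrimes

end
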